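import Summits.BirchSwinnertonDyer.Rank1Residual.Additive.StrictSignedSelmer
import Summits.BirchSwinnertonDyer.Rank1Residual.Additive.QuadraticBranchOddStrictSelmer
import HarnessLib

/-!
# Two READINGS of printed theorems on the strict-minus Selmer structure — Kobayashi 2003 Thm. 4.1
# (odd `η`, `n = 0`) + Thm. 2.2, and Kitajima–Otsuki 2018 Main Thm. 1.3 (sign `−`) — typed as
# INPUTS (cell `b2b-bsdres`, team n1011, r = 1 strand, seat p17 GEN 3; row T-O7ss-P13 FILE 4a; the
# theorem `(R1) → (R2) → QuadraticBranchOddStrictSelmerBoundAt W p` is FILE 4b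
# `QuadraticBranchOddStrictSelmerBound.lean`)

HONEST FRAMING (cell `b2b-bsdres`, run/shared/lean/b2b/bsd-rank1-residual/, verbatim in every
file): the goal of the cell is to DELETE the COMBINATION-SHAPED residual classes of the
Birch–Swinnerton-Dyer formula for ALL analytic-rank `≤ 1` elliptic curves over `ℚ` — "full BSD
formula for every rank `≤ 1` curve in class `C`" assembled STRICTLY from published theorems — so
that the rank-`≤ 1` remainder becomes exactly the CONSTRUCTION-SHAPED classes, which are TYPED
(missing-input `Prop`s), NOT attempted. This is not "finishing BSD". Team n1011: prove what is
provable now; shrink each hard class to its core with data; no claim beyond stated classes; research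
routes; census output = EVIDENCE / conjecture items, never a Literature fact; RESIDUAL-MAP marks
change only by signed lines. O7-ss stays OPEN, X4 CONSTRUCTION-SHAPED; nothing here is booked; no
label moves. This file: THREE `@[conjecture] def` typed inputs — READINGS of printed theorems (one of them on
top of the sibling's typed conjecture (C1_η)) through the `η`-twist dictionary; NOTHING asserted; NO Literature fact minted (ABSOLUTE RULE: the
VERBATIM transcriptions on `V` over `ℚ(μ_{p^∞})` (P2) and the dictionary theorem (P5: prime-to-`p`
descent + twist, the additive-p1/p2 `ChiEigenPrimeToPDescent` / `TwistDescent` pattern) are the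
row's named follow-ups; whether the readings may become flagged Literature facts is the typer lane's
decision — cc-typer-6 / n1011-lit). They replace NOTHING of p259634; they refine its
assembly-shaped input `QuadraticBranchOddStrictSelmerBoundAt` into two reading-shaped ones.

## Frame and dictionary (flags `Kob03-Thm41-odd-eta-twist-reading`, `Kob03-Thm74-odd-eta-twist-reading`,
## `KO18-minus-eta-twist-reading`)

p259634's frame: `p` odd, `p* = (−1)^{(p−1)/2} p`, `W/ℚ` globally minimal with `C • W^{(p*)} = V`
globally minimal, GOOD at `p`, `a_p(V) = 0`; `η = ω^{(p−1)/2}`; `K_n = ℚ(ζ_{p^{n+1}})`,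
`K_∞ = ℚ(μ_{p^∞})`. DICTIONARY (cc-typer-6's route note `HOME/class-closure/O10/ROUTE-ETA-ODD-STRICT-
typer6.md`; folklore prime-to-`p` descent + twist: `W[p^∞] ≅ V[p^∞] ⊗ η`, `(V̂(K_{n,v}))^η =
W(ℚ_{n,p}) ⊗ ℤ_p`, `V̂(ℚ_p)^η = 0`): Kobayashi's `X⁻(V/K_∞)^η` IS, as a `Λ`-module, the dual
`X^{−,str}(W/ℚ_∞)` of the strict-minus Selmer group of `W` over the cyclotomic `ℤ_p`-extension of
`ℚ` with the model `ℚ_[p]` at `p` (`StrictSignedSelmerDualData W κ ℚ_[p] γ (-1)`, FILE 2a), with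
`T = γ − 1`, `γ ↦ 1 + X` for a topological generator matching the cyclotomic variable
(`IsCyclotomicVariable`; Kobayashi §3 p. 5 "we identify `γ` with `1 + X`").

References: [Kobayashi2003] Thm. 2.2 (p. 5), §4 Odd main conjecture + Thm. 4.1 (p. 8), §2 p. 4,
§3 p. 5; [KitajimaOtsuki2018] Main Thm. 1.3 (= Thm. 4.8), Def. 2.1 (arXiv:1607.03612 pp. 3, 6);
cc-typer-6 p259634 / p261032.
-/

noncomputable section

open scoped Classical MatrixGroups ModularForm

open CongruenceSubgroup WeierstrassCurve Literature.NumberTheory.EllipticCurves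
  Literature.NumberTheory.EllipticCurves.ModularForms
  Literature.NumberTheory.EllipticCurves.Kobayashi2003
  Literature.NumberTheory.GaloisRepresentations ZpExtension

namespace Summit.BirchSwinnertonDyer.Rank1Residual.Additive

/-! ## §1 The two readings (typed inputs; NOTHING asserted) -/

/-- **TYPED INPUT (R1) — READING of Kobayashi 2003 Thm. 2.2 + Thm. 4.1 (odd sign, `η =
ω^{(p−1)/2} ≠ 1`, `n = 0`) through the `η`-twist dictionary; flag `Kob03-Thm41-odd-eta-twist-reading`;
NOTHING asserted.** For `W/ℚ` globally minimal, `p` odd, `V` a globally minimal model of the twist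
`W^{(p*)}` with good reduction at `p` and `a_p(V) = 0`, `Gal(ℚ̄/ℚ) → GL_{ℤ_p}(T_pV)` surjective
(`∀ m, V.HasSurjectiveModNGaloisRep (p^m)`), `f` the newform of `V`, `ϖ` the period ratio of the
parity of `η`, `Lη` ANY function with the interpolation property of `L_p⁻(V, η, X)`
(`IsQuadraticBranchMinusLFunction`), the cyclotomic `ℤ_p`-extension `κ` of `ℚ` and a topological
generator `γ` matching the cyclotomic variable: EVERY Pontryagin-dual datum `D` of the STRICT-MINUS
Selmer group of `W` (model `ℚ_[p]`; `=` Kobayashi's `X⁻(V/K_∞)^η` under the dictionary) is finitely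
generated `Λ`-torsion (Thm. 2.2), and every generator `g` of its characteristic ideal divides
`X⁻¹Lη` (Thm. 4.1 with `n = 0`: "`Char(X⁻(E/K_∞)^η) ⊇ (X⁻¹L_p⁻(E, η, X))`"), stated as `g ∣ L'`
for `Lη = X·L'`. The VERBATIM transcription on `V` over `ℚ(μ_{p^∞})` and the dictionary theorem are
the row's follow-ups (P2)/(P5); until then this is an INPUT exactly as p259634's.
[cite: Kobayashi2003, Thm. 2.2 (p. 5) and §4 Odd main conjecture + Thm. 4.1 (p. 8); §2 p. 4 (the η-components, m = −1)] -/
@[conjecture] def OddBranchStrictMinusDivisibilityAt (W : WeierstrassCurve ℚ) [W.IsElliptic]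
    [W.IsGloballyMinimal] (p : ℕ) [Fact p.Prime] : Prop :=
  ∀ (V : WeierstrassCurve ℚ) [V.IsElliptic] [V.IsGloballyMinimal] (C : VariableChange ℚ)
    {N : ℕ} [NeZero N] {f : CuspForm (Gamma0 N) 2},
    p ≠ 2 → C • W.quadraticTwist ((-1) ^ (p / 2) * p) = V →
    V.HasGoodReductionAtPrime p → V.frobeniusTrace p = 0 →
    (∀ m : ℕ, V.HasSurjectiveModNGaloisRep (p ^ m : ℕ)) →
    IsNewformOf V f →
    ∀ (ϖ : ℚ), (if Even (p / 2) then (ϖ : ℝ) * V.realPeriodRat = plusPeriod f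
        else (ϖ : ℝ) * V.imaginaryPeriodRat = minusPeriod f) →
    ∀ (Lη : IwasawaAlgebra p), IsQuadraticBranchMinusLFunction f p ϖ Lη →
    ∀ (κ : ZpExtension ℚ p) (γ : Field.absoluteGaloisGroup ℚ),
      κ.IsCyclotomic → κ.IsTopGenerator γ → IsCyclotomicVariable p γ →
    ∀ (D : StrictSignedSelmerDualData W κ ℚ_[p] γ (-1)),
      Module.Finite (IwasawaAlgebra p) D.X ∧ Module.IsTorsion (IwasawaAlgebra p) D.X ∧
        ∀ (g L' : IwasawaAlgebra p), D.charIdeal = Ideal.span {g} →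
          Lη = PowerSeries.X * L' → g ∣ L'

/-- **TYPED INPUT (R3) — READING of Kobayashi 2003 Thm. 7.4 ("Kato's main conjecture, the even main
conjecture and the odd main conjecture are equivalent", `η`-component by `η`-component, p. 13) on
top of the sibling's typed (C1_η) `QuadraticBranchPlusMainConjectureAt V p` (Kobayashi's EVEN main
conjecture for `V` at `η`, CONJECTURE IN PRINT), through the `η`-twist dictionary; flag
`Kob03-Thm74-odd-eta-twist-reading`; NOTHING asserted.** Same frame as (R1) WITHOUT the image
hypothesis: if (C1_η) holds for `V` at `p`, then the ODD main conjecture holds at `η`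
(`Char X⁻(V/K_∞)^η = (X⁻¹L_p⁻(V, η, X))` EXACTLY), so every strict-minus dual datum `D` of `W`
(model `ℚ_[p]`) is finitely generated torsion (Thm. 2.2) and every generator `g` of its
characteristic ideal divides `X⁻¹Lη` — the image-free CONDITIONAL form for the twins `V` whose
`p`-adic image is not onto (the 107 of 515 cells of cc-typer-6's census where Thm. 4.1's `pⁿ` is
not effective); the reading-shaped refinement of p259634's `QuadraticBranchOddStrictSelmerBoundOfPlusMCAt`.
NOT an O10 route (O10 class lead's ruling, p259634 SCOPE). [cite: Kobayashi2003, Thm. 7.4 (p. 13), §4 (p. 8), Thm. 2.2 (p. 5)]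
[cite: PollackRubin2004, Theorem and the remark on Sel over ℚ(μ_{p^∞}) (p. 448)] -/
@[conjecture] def OddBranchStrictMinusDivisibilityOfPlusMCAt (W : WeierstrassCurve ℚ) [W.IsElliptic]
    [W.IsGloballyMinimal] (p : ℕ) [Fact p.Prime] : Prop :=
  ∀ (V : WeierstrassCurve ℚ) [V.IsElliptic] [V.IsGloballyMinimal] (C : VariableChange ℚ)
    {N : ℕ} [NeZero N] {f : CuspForm (Gamma0 N) 2},
    p ≠ 2 → C • W.quadraticTwist ((-1) ^ (p / 2) * p) = V →
    V.HasGoodReductionAtPrime p → V.frobeniusTrace p = 0 →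
    QuadraticBranchPlusMainConjectureAt V p →
    IsNewformOf V f →
    ∀ (ϖ : ℚ), (if Even (p / 2) then (ϖ : ℝ) * V.realPeriodRat = plusPeriod f
        else (ϖ : ℝ) * V.imaginaryPeriodRat = minusPeriod f) →
    ∀ (Lη : IwasawaAlgebra p), IsQuadraticBranchMinusLFunction f p ϖ Lη →
    ∀ (κ : ZpExtension ℚ p) (γ : Field.absoluteGaloisGroup ℚ),
      κ.IsCyclotomic → κ.IsTopGenerator γ → IsCyclotomicVariable p γ →
    ∀ (D : StrictSignedSelmerDualData W κ ℚ_[p] γ (-1)),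
      Module.Finite (IwasawaAlgebra p) D.X ∧ Module.IsTorsion (IwasawaAlgebra p) D.X ∧
        ∀ (g L' : IwasawaAlgebra p), D.charIdeal = Ideal.span {g} →
          Lη = PowerSeries.X * L' → g ∣ L'

/-- **TYPED INPUT (R2) — READING of Kitajima–Otsuki 2018 Main Thm. 1.3 (sign `−`, `F_0 = ℚ(μ_p)`,
`a_p = 0`) through the `η`-twist dictionary; flag `KO18-minus-eta-twist-reading`; NOTHING
asserted.** For `W`, `p`, `V`, `C` as in (R1) (no image hypothesis, no newform: the printed theorem
needs neither), the cyclotomic `κ` and any topological generator `γ`: every Pontryagin-dual datum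
of the strict-minus Selmer group of `W` (model `ℚ_[p]`) whose module is finitely generated and
`Λ`-torsion (the printed hypothesis (vi), displayed as in the tree's sign-`+` fact; discharged in
print for `F = ℚ` by Kobayashi Thm. 2.2) has NO non-trivial finite `Λ`-submodule ("both
`Sel^±(F_∞, E[p^∞])^∨` have no nontrivial finite `Λ`-submodule", Def. 2.1 with "`−1 ≤ m`" for the
sign `−`; an `η`-part inherits the property). CITE NOTE (cell bsd-cm's referee reading REF-6′,
wording only; statement unchanged): the printed hypothesis (vi) — BOTH duals `Λ`-torsion, all
components — is supplied in print for `F = ℚ` by Kobayashi's Thm. 2.2 (p. 5) = Thm. 7.3 ii) (p. 13),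
which is load-bearing for this reading beside Main Thm. 1.3; the displayed torsion hypothesis below
(the minus datum only) is what a consumer instantiates.
[cite: KitajimaOtsuki2018, Main Thm. 1.3 (= Thm. 4.8) with Def. 2.1 (arXiv:1607.03612 pp. 3, 6)]
[cite: Kobayashi2003, Thm. 2.2 (p. 5) and Thm. 7.3 ii) (p. 13) (the torsion hypothesis (vi), both signs, every η)] -/
@[conjecture] def OddBranchStrictMinusNoFiniteSubmoduleAt (W : WeierstrassCurve ℚ) [W.IsElliptic]
    [W.IsGloballyMinimal] (p : ℕ) [Fact p.Prime] : Prop :=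
  ∀ (V : WeierstrassCurve ℚ) [V.IsElliptic] [V.IsGloballyMinimal] (C : VariableChange ℚ),
    p ≠ 2 → C • W.quadraticTwist ((-1) ^ (p / 2) * p) = V →
    V.HasGoodReductionAtPrime p → V.frobeniusTrace p = 0 →
    ∀ (κ : ZpExtension ℚ p) (γ : Field.absoluteGaloisGroup ℚ),
      κ.IsCyclotomic → κ.IsTopGenerator γ →
    ∀ (D : StrictSignedSelmerDualData W κ ℚ_[p] γ (-1)),
      Module.Finite (IwasawaAlgebra p) D.X → Module.IsTorsion (IwasawaAlgebra p) D.X →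
      ∀ (M : Submodule (IwasawaAlgebra p) D.X), Finite M → M = ⊥


end Summit.BirchSwinnertonDyer.Rank1Residual.Additive

end
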